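import Mathlib
import HarnessLib
import Summits.MatrixMultiplication.MatrixMultiplication.Theorems.OutsiderSandwichToricCeilingPowSubTwo
import Summits.MatrixMultiplication.MatrixMultiplication.Theorems.OutsiderSandwichToricCeilingPowMixed
import Summits.MatrixMultiplication.MatrixMultiplication.Theorems.OutsiderSandwichToricCeilingPowMixedBase

/-!
# OutsiderSandwich — no toric `⟨3^N - 2⟩` in any product frame of `cw₂^{⊠N}` with at most one
Coppersmith–Winograd coordinate, every `N ≥ 3` (unconditional)
(decomp-mm lens 4, gen 46, kernel K46-9; THESES-FREE, `ω`-free; helper toward `LaserTangency`,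
stmt-32268 — the extremal subrank/packing cells of the literal host `kroneckerPow (cwTensor ℂ 2) N`)

LABEL.  TORIC · UNIFORM IN `N` (a theorem for every `N ≥ 3`) · NEC-side instrument of the
decomposition cell; the rates / the crux `h₁ = LaserTangency` and the route's `closes` are
untouched.

WHAT.  The `N = 2` census `…PowMixedBase.mixedBaseTwo` discharges the hypothesis `hB` of
`…PowMixed.productFrame_oneCw_no_diagonal_comb_degeneration_sub_two`; together with the tight
case `…PowSubTwo.tightFrame_pow_no_diagonal_comb_degeneration_sub_two` (K45): in the product frame
`frame κ` of ANY product basis `κ : Fin N → Bool` with AT MOST ONE cw coordinate, `N ≥ 3`, no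
diagonal-free `Ψ` with `#Ψ ≥ 3^N - 2` is a combinatorial degeneration, i.e. the toric value of
these frames is `≤ 3^N - 3`.  (Sharpness/status: at `N = 2` the values are `6` (tight) and `7`
(mixed), `…TightSeven` / `…MixedSeven`; for `N = 3` the cell's censuses give `≤ 22` in the tight
basis — DATA, not a theorem; frames with `≥ 2` cw coordinates are not treated: at `N = 2` the
frame `cw ⊠ cw` has lawful complements WITHOUT a perfect matching, NODE-g46 §3, so the matching
engine needs a new idea there.)
-/

set_option linter.dupNamespace false

namespace Summit.MatrixMultiplication.MatrixMultiplication.Theorems.OutsiderSandwichToricCeilingPowMixedSubTwo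

open Finset
open Summit.MatrixMultiplication.MatrixMultiplication.Theorems.OutsiderSandwichToricCeilingPowFibres
  (Word Tr3 frame)
open Summit.MatrixMultiplication.MatrixMultiplication.Theorems.OutsiderSandwichToricCeilingPowSubTwo
  (tightFrame_pow_no_diagonal_comb_degeneration_sub_two)
open Summit.MatrixMultiplication.MatrixMultiplication.Theorems.OutsiderSandwichToricCeilingPowMixed
  (productFrame_oneCw_no_diagonal_comb_degeneration_sub_two)
open Summit.MatrixMultiplication.MatrixMultiplication.Theorems.OutsiderSandwichToricCeilingPowMixedBase
  (mixedBaseTwo)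

/-- **Toric ceiling `⟨3^N - 2⟩` in ONE-CW product frames, all `N ≥ 3` — unconditional.**
[TORIC · uniform in N ≥ 3 · NEC-side instrument] -/
theorem productFrame_oneCw_no_diagonal_comb_degeneration_sub_two' {R : Type*} [CommRing R]
    [LinearOrder R] [IsStrictOrderedRing R] {N : ℕ} (hN : 3 ≤ N) (κ : Fin N → Bool)
    (hκ : ∀ i j, κ i = true → κ j = true → i = j) (hcw : ∃ i, κ i = true)
    {Ψ : Finset (Tr3 N)} {a b c : Word N → R} (hsub : Ψ ⊆ frame κ)
    (hzero : ∀ t ∈ Ψ, a t.1 + b t.2.1 + c t.2.2 = 0)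
    (hone : ∀ t ∈ frame κ, t ∉ Ψ → 1 ≤ a t.1 + b t.2.1 + c t.2.2)
    (hdiag : ∀ t ∈ Ψ, ∀ t' ∈ Ψ, (t.1 = t'.1 ∨ t.2.1 = t'.2.1 ∨ t.2.2 = t'.2.2) → t = t')
    (hbig : 3 ^ N ≤ #Ψ + 2) : False :=
  productFrame_oneCw_no_diagonal_comb_degeneration_sub_two mixedBaseTwo hN κ hκ hcw hsub hzero hone
    hdiag hbig

/-- **Toric ceiling `⟨3^N - 2⟩` in every product frame with AT MOST ONE cw coordinate, all
`N ≥ 3`.**  No cw coordinate: the tight frame (`…PowSubTwo`, K45, already for `N ≥ 2`); exactly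
one: the previous theorem.  [TORIC · uniform in N ≥ 3 · NEC-side instrument] -/
theorem productFrame_atMostOneCw_no_diagonal_comb_degeneration_sub_two {R : Type*} [CommRing R]
    [LinearOrder R] [IsStrictOrderedRing R] {N : ℕ} (hN : 3 ≤ N) (κ : Fin N → Bool)
    (hκ : ∀ i j, κ i = true → κ j = true → i = j)
    {Ψ : Finset (Tr3 N)} {a b c : Word N → R} (hsub : Ψ ⊆ frame κ)
    (hzero : ∀ t ∈ Ψ, a t.1 + b t.2.1 + c t.2.2 = 0)
    (hone : ∀ t ∈ frame κ, t ∉ Ψ → 1 ≤ a t.1 + b t.2.1 + c t.2.2)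
    (hdiag : ∀ t ∈ Ψ, ∀ t' ∈ Ψ, (t.1 = t'.1 ∨ t.2.1 = t'.2.1 ∨ t.2.2 = t'.2.2) → t = t')
    (hbig : 3 ^ N ≤ #Ψ + 2) : False := by
  by_cases hcw : ∃ i, κ i = true
  · exact productFrame_oneCw_no_diagonal_comb_degeneration_sub_two' hN κ hκ hcw hsub hzero hone
      hdiag hbig
  · obtain rfl : κ = fun _ => false := funext fun i => by simpa using fun h => hcw ⟨i, h⟩
    exact tightFrame_pow_no_diagonal_comb_degeneration_sub_two (by omega) hsub hzero hone hdiag hbig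

end Summit.MatrixMultiplication.MatrixMultiplication.Theorems.OutsiderSandwichToricCeilingPowMixedSubTwo
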